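import Summits.KontsevichZagierPeriods.KontsevichZagierPeriods.Theorems.RootDecompRationalCubeDichotomyLogFibreP3
import Summits.KontsevichZagierPeriods.KontsevichZagierPeriods.Theorems.RootDecompRationalCubeDichotomyArctanFibreP1

/-!
# Log-fibre calculus for `RationalCubePiKernelSingle` (route `RootDecompRationalCubeDichotomy`, crux stmt-KontsevichZagierPeriods-26322) at `m = 2` · part 4/4

Cell `decomp-kz`, lens 2 (decomp-kz-lens-2 g6): the LOG-FIBRE SECTOR `Λ[E] = [[0,1]², E(y)/(1 + x·y·E(y))]`
(`E ∈ ℚ(y)` regular, `≥ 0`) is closed under the moves by RULE (2) ONLY — product rule `lam_mul`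
(`Λ[E₁+E₂+yE₁E₂] ≡ Λ[E₁] + Λ[E₂]`, a fibred chart) and power rule `lam_pow`; inside it the whole `π²`-class of the
cell's weight-2 census (`census₂ … census₆`, 15/15 pairs) and the route's `EulerInstance`
(`euler_rel : 3•[□,1/(1+xy)] − 4•[□,1/((1+x²)(1+y²))] ∈ KZ.relations`) are DECIDED with `N = 0`, and
`single_inst₂ … single_inst₆`, `single_instEuler` are the corresponding LITERAL instances of the binder list of
`RationalCubePiKernelSingle` at `m = 2` (the route decl is not referenced by name, so these modules do not import
the route file).

Source: `HOME/decomp-kz-lens-2/g6/LogFibreCalculus.lean` sha256 73bd8b5e80afc467 (1113 l; critic decomp-kz-crit-1 g2 CLEARED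
2026-08-30T08:00:40Z incl. the binder check, std axioms), split into 4 modules by the landing seat decomp-kz-census-1 g7
(contexts re-opened per part; generic docstrings added where the source had none).  No `sorry`; standard axioms.
References: [cite: KontsevichZagier2001, §1.2].
-/

noncomputable section
open Set MeasureTheory MvPolynomial
open Literature.ModelTheory.ExponentialFields (IsSemialgebraic)
open Literature.NumberTheory.Transcendental
open Literature.NumberTheory.Transcendental.KZ
open Literature.NumberTheory.Transcendental.KZ.RFun
open Summit.KontsevichZagierPeriods.KontsevichZagierPeriods.Theorems

namespace Summit.KontsevichZagierPeriods.RootDecompRationalCubeDichotomy.LogFibre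

-- shared generalities landed first in the arctan-fibre module (dedup.landed): reuse them
open Summit.KontsevichZagierPeriods.RootDecompRationalCubeDichotomy.ArctanFibre (pi_univ_Icc_eq_cube single_of_rel)

section Census

/-- **`RationalCubePiKernelSingle` at `(m, P, Q) = (2, d₂.num, d₂.den)`** — binders verbatim. -/
theorem single_inst₂ (q : KZ.IntegralRep 2)
    (hdom : q.domain = Set.pi Set.univ (fun _ : Fin 2 => Set.Icc (0 : ℝ) 1))
    (_hQ : ∀ z ∈ Set.pi Set.univ (fun _ : Fin 2 => Set.Icc (0 : ℝ) 1),
      MvPolynomial.aeval z d2.den ≠ 0)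
    (hint : ∀ z ∈ Set.pi Set.univ (fun _ : Fin 2 => Set.Icc (0 : ℝ) 1),
      q.integrand z = MvPolynomial.aeval z d2.num / MvPolynomial.aeval z d2.den)
    (_hv : q.value = 0) :
    ∃ N : ℕ, (fun y : KZ.FormalRep => KZ.of KZ.piRep * y)^[N] (KZ.of q) ∈ KZ.relations :=
  single_of_rel d2 d2_rel q hdom hint
/-- `… (2, d₃.num, d₃.den)`. -/
theorem single_inst₃ (q : KZ.IntegralRep 2)
    (hdom : q.domain = Set.pi Set.univ (fun _ : Fin 2 => Set.Icc (0 : ℝ) 1))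
    (_hQ : ∀ z ∈ Set.pi Set.univ (fun _ : Fin 2 => Set.Icc (0 : ℝ) 1),
      MvPolynomial.aeval z d3.den ≠ 0)
    (hint : ∀ z ∈ Set.pi Set.univ (fun _ : Fin 2 => Set.Icc (0 : ℝ) 1),
      q.integrand z = MvPolynomial.aeval z d3.num / MvPolynomial.aeval z d3.den)
    (_hv : q.value = 0) :
    ∃ N : ℕ, (fun y : KZ.FormalRep => KZ.of KZ.piRep * y)^[N] (KZ.of q) ∈ KZ.relations :=
  single_of_rel d3 d3_rel q hdom hint
/-- `… (2, d₄.num, d₄.den)`. -/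
theorem single_inst₄ (q : KZ.IntegralRep 2)
    (hdom : q.domain = Set.pi Set.univ (fun _ : Fin 2 => Set.Icc (0 : ℝ) 1))
    (_hQ : ∀ z ∈ Set.pi Set.univ (fun _ : Fin 2 => Set.Icc (0 : ℝ) 1),
      MvPolynomial.aeval z d4.den ≠ 0)
    (hint : ∀ z ∈ Set.pi Set.univ (fun _ : Fin 2 => Set.Icc (0 : ℝ) 1),
      q.integrand z = MvPolynomial.aeval z d4.num / MvPolynomial.aeval z d4.den)
    (_hv : q.value = 0) :
    ∃ N : ℕ, (fun y : KZ.FormalRep => KZ.of KZ.piRep * y)^[N] (KZ.of q) ∈ KZ.relations :=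
  single_of_rel d4 d4_rel q hdom hint
/-- `… (2, d₅.num, d₅.den)`. -/
theorem single_inst₅ (q : KZ.IntegralRep 2)
    (hdom : q.domain = Set.pi Set.univ (fun _ : Fin 2 => Set.Icc (0 : ℝ) 1))
    (_hQ : ∀ z ∈ Set.pi Set.univ (fun _ : Fin 2 => Set.Icc (0 : ℝ) 1),
      MvPolynomial.aeval z d5.den ≠ 0)
    (hint : ∀ z ∈ Set.pi Set.univ (fun _ : Fin 2 => Set.Icc (0 : ℝ) 1),
      q.integrand z = MvPolynomial.aeval z d5.num / MvPolynomial.aeval z d5.den)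
    (_hv : q.value = 0) :
    ∃ N : ℕ, (fun y : KZ.FormalRep => KZ.of KZ.piRep * y)^[N] (KZ.of q) ∈ KZ.relations :=
  single_of_rel d5 d5_rel q hdom hint
/-- `… (2, d₆.num, d₆.den)`. -/
theorem single_inst₆ (q : KZ.IntegralRep 2)
    (hdom : q.domain = Set.pi Set.univ (fun _ : Fin 2 => Set.Icc (0 : ℝ) 1))
    (_hQ : ∀ z ∈ Set.pi Set.univ (fun _ : Fin 2 => Set.Icc (0 : ℝ) 1),
      MvPolynomial.aeval z d6.den ≠ 0)
    (hint : ∀ z ∈ Set.pi Set.univ (fun _ : Fin 2 => Set.Icc (0 : ℝ) 1),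
      q.integrand z = MvPolynomial.aeval z d6.num / MvPolynomial.aeval z d6.den)
    (_hv : q.value = 0) :
    ∃ N : ℕ, (fun y : KZ.FormalRep => KZ.of KZ.piRep * y)^[N] (KZ.of q) ∈ KZ.relations :=
  single_of_rel d6 d6_rel q hdom hint

end Census

/-! ## 6. The route's `EulerInstance` as a `26322` instance: `3•[□,1/(1+xy)] ≡ 4•[□,1/((1+x²)(1+y²))]`

`Λ[1] = π²/12` is glued to `SoloBlind.altBoxRep 2` (same integrand on the open box; null boundary),
which lies in the `π`-sector `M_π`; `[□, 1/((1+y²)(1+x²))]` is the tensor square of the arctangent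
density `[[0,1], 1/(1+y²)] = π/4 ∈ B(π) ⊆ M_π`; the `π`-sector kernel theorem
(`SoloBlind.piSector_kernel`: an element of `M_π` with value `0` is a relation) closes it. This is
the BC5 rung of the route dossier, now an unconditional theorem of the `[0,1]²` calculus. -/

section Euler

/-- `cube_one_eq_line`: auxiliary theorem of the log-fibre calculus for `RationalCubePiKernelSingle` (stmt-26322) — see the module docstring; verbatim from the lens-2 g6 file. -/
theorem cube_one_eq_line : KZ.cube 1 = SoloBlind.line (Icc (0 : ℝ) 1) := by
  ext x
  simp only [KZ.mem_cube, Fin.forall_fin_one, SoloBlind.mem_line, mem_Icc]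

/-- `[[0,1], 1/(1+y²)] = π/4`. -/
theorem eR5_value : eR5.rep.value = Real.pi / 4 := by
  have hint : ∀ x : Fin 1 → ℝ, eR5.rep.integrand x = (fun t : ℝ => 1 / (1 + t ^ 2)) (x 0) := by
    intro x
    simp [rep_integrand, fn_apply, eR5]
  rw [KZ.IntegralRep.value, rep_domain, cube_one_eq_line]
  have hI : (∫ x in SoloBlind.line (Icc (0 : ℝ) 1), eR5.rep.integrand x) =
      ∫ x in SoloBlind.line (Icc (0 : ℝ) 1), (fun t : ℝ => 1 / (1 + t ^ 2)) (x 0) := by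
    congr 1
    funext x
    exact hint x
  rw [hI, SoloBlind.setIntegral_line (Icc (0 : ℝ) 1) (fun t : ℝ => 1 / (1 + t ^ 2)),
    MeasureTheory.integral_Icc_eq_integral_Ioc, ← intervalIntegral.integral_of_le zero_le_one,
    integral_one_div_one_add_sq, Real.arctan_one, Real.arctan_zero, sub_zero]

/-- The arctangent density is KZ-rational. -/
theorem eR5_isRational : eR5.rep.IsRational :=
  ⟨1, 1 + X 0 ^ 2, q4_ne, fun _ _ => rfl⟩

/-- `[[0,1], 1/(1+y²)] ∈ M_π` (via the rank-one ring `B(π)`). -/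
theorem of_eR5_mem_piSector : KZ.of eR5.rep ∈ SoloBlind.piSector :=
  SoloBlind.lineRing_pi_le_piSector
    (SoloBlind.of_mem_lineRing eR5.rep le_rfl eR5_isRational isAlgebraic_zero
      (isAlgebraic_algebraMap (1 / 4 : ℚ)) (by rw [eR5_value, eq_ratCast]; push_cast; ring))

/-- `E₂ = [□, 1/((1+y²)(1+x²))]`, the tensor square of the arctangent density. -/
def eSq : RFun 2 := eR5.tensor eR5

/-- Its integrand. -/
theorem fn_eSq (z : Fin 2 → ℝ) : eSq.fn z = 1 / (1 + z 0 ^ 2) * (1 / (1 + z 1 ^ 2)) := by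
  rw [show eSq = eR5.tensor eR5 from rfl, fn_tensor]
  simp [fn_apply, eR5]

/-- `of_eSq_mem_piSector`: auxiliary theorem of the log-fibre calculus for `RationalCubePiKernelSingle` (stmt-26322) — see the module docstring; verbatim from the lens-2 g6 file. -/
theorem of_eSq_mem_piSector : KZ.of eSq.rep ∈ SoloBlind.piSector := by
  have ht : KZ.of eR5.rep * KZ.of eR5.rep - KZ.of eSq.rep ∈ KZ.relations := rel_tensor eR5 eR5
  have hp : KZ.of eR5.rep * KZ.of eR5.rep ∈ SoloBlind.piSector :=
    mul_mem of_eR5_mem_piSector of_eR5_mem_piSector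
  convert sub_mem hp (SoloBlind.relations_le_piSector ht) using 1
  exact (sub_sub_cancel _ _).symm

/-- `[0,1]² ∖ (0,1)²` is null. -/
theorem volume_cube_two_diff_kzOpenBox : volume (KZ.cube 2 \ SoloBlind.kzOpenBox 2) = 0 := by
  have hp : ∀ (i : Fin 2) (a : ℝ), volume {z : Fin 2 → ℝ | z i = a} = 0 := fun i a => by
    rw [MeasureTheory.volume_pi]
    exact Measure.pi_hyperplane (fun _ : Fin 2 => (volume : Measure ℝ)) i a
  refine measure_mono_null (fun z ⟨hC, hO⟩ => ?_)
    (measure_union_null (measure_union_null (hp 0 0) (hp 0 1))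
      (measure_union_null (hp 1 0) (hp 1 1)))
  by_contra h
  simp only [mem_union, mem_setOf_eq, not_or] at h
  refine hO fun i => ?_
  fin_cases i
  · exact ⟨lt_of_le_of_ne (hC 0).1 (Ne.symm h.1.1), lt_of_le_of_ne (hC 0).2 h.1.2⟩
  · exact ⟨lt_of_le_of_ne (hC 1).1 (Ne.symm h.2.1), lt_of_le_of_ne (hC 1).2 h.2.2⟩

/-- `[□, 1/(1+xy)] ≡ SoloBlind.altBoxRep 2` (closed vs open square: a null modification). -/
theorem cB_sub_altBox : KZ.of cB.rep - KZ.of (SoloBlind.altBoxRep 2 le_rfl) ∈ KZ.relations := by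
  refine KZ.of_sub_of_mem_relations_of_null _ _ volume_cube_two_diff_kzOpenBox ?_ ?_
  · have hsub : (SoloBlind.altBoxRep 2 le_rfl).domain ⊆ cB.rep.domain :=
      fun z hz i => ⟨(hz i).1.le, (hz i).2.le⟩
    exact measure_mono_null (fun z hz => absurd (hsub hz.1) hz.2) measure_empty
  · rintro z ⟨hz, -⟩
    show cB.fn z = 1 / (1 + ∏ i, z i)
    simp only [cB, fn_apply, map_one, map_add, map_mul, aeval_X, Fin.prod_univ_two, mul_comm]

/-- `of_cB_mem_piSector`: auxiliary theorem of the log-fibre calculus for `RationalCubePiKernelSingle` (stmt-26322) — see the module docstring; verbatim from the lens-2 g6 file. -/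
theorem of_cB_mem_piSector : KZ.of cB.rep ∈ SoloBlind.piSector := by
  simpa using add_mem (SoloBlind.relations_le_piSector cB_sub_altBox)
    SoloBlind.of_altBoxTwo_mem_piSector

/-- `[□, 1/(1+xy)] = π²/12`. -/
theorem cB_value : cB.rep.value = Real.pi ^ 2 / 12 := by
  rw [← SoloBlind.altBoxRep_two_value]
  exact KZ.Equivalent.value_eq_holds cB_sub_altBox

/-- `[□, 1/((1+y²)(1+x²))] = (π/4)²`. -/
theorem eSq_value : eSq.rep.value = (Real.pi / 4) ^ 2 := by
  have h := KZ.relations_le_ker_eval_holds (rel_tensor eR5 eR5)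
  simp only [AddMonoidHom.mem_ker, map_sub, KZ.eval_mul', KZ.eval_of, eR5_value, sub_eq_zero] at h
  rw [show eSq.rep.value = (eR5.tensor eR5).rep.value from rfl, ← h]
  ring

/-- **The Euler instance is an explicit relation**: `3•[□,1/(1+xy)] - 4•[□,1/((1+y²)(1+x²))] ∈
relations` (`3·π²/12 = 4·(π/4)²`), by the `π`-sector kernel theorem. -/
theorem euler_rel : 3 • KZ.of cB.rep - 4 • KZ.of eSq.rep ∈ KZ.relations := by
  refine SoloBlind.piSector_kernel
    (sub_mem (nsmul_mem of_cB_mem_piSector 3) (nsmul_mem of_eSq_mem_piSector 4)) ?_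
  rw [map_sub, map_nsmul, map_nsmul, KZ.eval_of, KZ.eval_of, cB_value, eSq_value]
  simp only [nsmul_eq_mul]
  push_cast
  ring

/-- `d_E = [□, 3/(1+xy) - 4/((1+y²)(1+x²))]` as one fraction (the route's `EulerInstance`). -/
def dE : RFun 2 := ((const ((3 : ℕ) : ℚ)).mul cB).sub ((const ((4 : ℕ) : ℚ)).mul eSq)

/-- `dE_rel`: auxiliary theorem of the log-fibre calculus for `RationalCubePiKernelSingle` (stmt-26322) — see the module docstring; verbatim from the lens-2 g6 file. -/
theorem dE_rel : KZ.of dE.rep ∈ KZ.relations := by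
  convert add_mem (sub_mem (add_mem (rel_sub ((const ((3 : ℕ) : ℚ)).mul cB)
    ((const ((4 : ℕ) : ℚ)).mul eSq)) (rel_constMul 3 cB)) (rel_constMul 4 eSq)) euler_rel using 1
  rw [dE]; abel

/-- Its value is `0` (as it must be). -/
theorem dE_value : dE.rep.value = 0 := by
  simpa [AddMonoidHom.mem_ker] using KZ.relations_le_ker_eval_holds dE_rel

/-- **`RationalCubePiKernelSingle` at the Euler instance `(2, d_E.num, d_E.den)`.** -/
theorem single_instEuler (q : KZ.IntegralRep 2)
    (hdom : q.domain = Set.pi Set.univ (fun _ : Fin 2 => Set.Icc (0 : ℝ) 1))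
    (_hQ : ∀ z ∈ Set.pi Set.univ (fun _ : Fin 2 => Set.Icc (0 : ℝ) 1),
      MvPolynomial.aeval z dE.den ≠ 0)
    (hint : ∀ z ∈ Set.pi Set.univ (fun _ : Fin 2 => Set.Icc (0 : ℝ) 1),
      q.integrand z = MvPolynomial.aeval z dE.num / MvPolynomial.aeval z dE.den)
    (_hv : q.value = 0) :
    ∃ N : ℕ, (fun y : KZ.FormalRep => KZ.of KZ.piRep * y)^[N] (KZ.of q) ∈ KZ.relations :=
  single_of_rel dE dE_rel q hdom hint

end Euler

end Summit.KontsevichZagierPeriods.RootDecompRationalCubeDichotomy.LogFibre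

end
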